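import Mathlib
import Summits.Ventures.PercRepro2.PendantO
import Summits.Ventures.PercRepro2.HalfL

/-!
# Both halves of (HCOV) when `a₃` is a leaf at `o` (blind cell PercRepro2, night-1 g36)

`PendantO.Gc_pendant_o` writes the crux functional, when `a₃` is a leaf at `o` (edge `f`, `q = p f`), as
`Gc = −2 (1 − q) P(Q) [C(oH, bL) + C(oL, bH)]` — `(1 − q)` times the `a₃`-free functional, the two
BHK06 1.4 cross-cluster slacks.  This file splits it TERM BY TERM into the two `b`-halves of
`SharpHalves.lean`:

* **`GammaLc_pendant_o`**: `ΓLc = −2 (1 − q) P(Q) · C(oH, bL)` (the `PendantO` rewrite chain on `GammaLc`,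
  then `ring`);
* **`HalfL_pendant_o`**, **`HalfH_pendant_o`**: HALF-L and HALF-H at every labelled instance whose `a₃` is a
  leaf at `o`, for every leaf weight (`PendantRoot.covC_cross_nonpos`).

With `HalfLRootLeaf.lean` (a root a leaf at `a₃`) and `HalfLPendantB.lean` (`a₃` a leaf at `b`) the two
halves are kernel theorems at every pendant position of `a₃` — `a₁`, `a₂`, `o`, `b` — as (HCOV) is
(`RootLeafA3`, `PendantO`, `RowCert`).  Reading: at a pendant `a₃` at `o` the centring is immaterial —
`Ξ_γ = −1_{oH}(1 − 1_f (1 − γ))` with `1_f` independent of `Q`, and `D − q(D − D_o) = (1 − q) P(Q)`.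
-/

namespace Summit.Ventures.PercRepro2

open UnionCluster CovForm PendantRoot PendantO

namespace HalfLPendantO

variable {V : Type*} {E : Type*} [Fintype E] [DecidableEq E] {R : Type*} [Field R]
  [LinearOrder R] [IsStrictOrderedRing R]

section Identity

variable (p : E → R) (ends : E → Sym2 V)

omit [LinearOrder R] [IsStrictOrderedRing R] in
/-- **The `L`-half at a pendant `a₃` attached to `o`**: `ΓLc = −2 (1 − q) P(Q) · C(oH, bL)`. -/
theorem GammaLc_pendant_o {f : E} {a₃ o : V} (hf : ends f = s(a₃, o))
    (hleaf : ∀ e, a₃ ∈ ends e → e = f) (h3o : a₃ ≠ o) {a₁ a₂ b : V} (h31 : a₃ ≠ a₁)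
    (h32 : a₃ ≠ a₂) (hb : b ≠ a₃) :
    SharpHalves.GammaLc p ends o a₁ a₂ a₃ b =
      -2 * (1 - p f) * prob p (avoidAll ends a₂ {a₁}) *
        covC p ends a₁ a₂ (connEvent ends a₂ o) (connEvent ends a₁ b) := by
  have ho : o ≠ a₃ := Ne.symm h3o
  have c₁o := free_connEvent hf hleaf h3o (Ne.symm h31) ho
  have c₂o := free_connEvent hf hleaf h3o (Ne.symm h32) ho
  have c₁b := free_connEvent hf hleaf h3o (Ne.symm h31) hb
  unfold SharpHalves.GammaLc DEF EQo EQ3 EQ3o Do covC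
  simp only [prob_PD_o p hf hleaf h3o h31 h32, prob_T_o p hf hleaf h3o h31 h32,
    prob_T'_o p hf hleaf h3o h31 h32,
    prob_PD_inter_o p hf hleaf h3o h31 h32 c₁b,
    prob_PD_inter_o p hf hleaf h3o h31 h32 c₁o, prob_PD_inter_o p hf hleaf h3o h31 h32 c₂o,
    prob_PD_inter_o p hf hleaf h3o h31 h32 (c₁o.inter c₁b),
    prob_PD_inter_o p hf hleaf h3o h31 h32 (c₂o.inter c₁b),
    prob_T_inter_o p hf hleaf h3o h31 h32 c₁b,
    prob_T_inter_o p hf hleaf h3o h31 h32 c₁o, prob_T_inter_o p hf hleaf h3o h31 h32 c₂o,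
    prob_T_inter_o p hf hleaf h3o h31 h32 (c₁o.inter c₁b),
    prob_T_inter_o p hf hleaf h3o h31 h32 (c₂o.inter c₁b),
    prob_T'_inter_o p hf hleaf h3o h31 h32 c₁b,
    prob_T'_inter_o p hf hleaf h3o h31 h32 c₁o, prob_T'_inter_o p hf hleaf h3o h31 h32 c₂o,
    prob_T'_inter_o p hf hleaf h3o h31 h32 (c₁o.inter c₁b),
    prob_T'_inter_o p hf hleaf h3o h31 h32 (c₂o.inter c₁b),
    Q_inter_idem, Q_inter_both_eq_empty, Q_inter_both_eq_empty', Q_inter_both_eq_empty₂,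
    Q_inter_both_eq_empty₂', prob_empty, Set.inter_self]
  ring

end Identity

section Theorem

variable [Fintype V] [DecidableEq V] (p : E → R) (ends : E → Sym2 V)

/-- **HALF-L at every pendant `a₃` attached to `o`**, for every leaf weight (BHK06 1.4). -/
theorem HalfL_pendant_o (hp : IsProbVec p) {f : E} {a₃ o : V} (hf : ends f = s(a₃, o))
    (hleaf : ∀ e, a₃ ∈ ends e → e = f) (h3o : a₃ ≠ o) {a₁ a₂ b : V} (h31 : a₃ ≠ a₁)
    (h32 : a₃ ≠ a₂) (hb : b ≠ a₃) : SharpHalves.HalfL p ends o a₁ a₂ a₃ b := by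
  unfold SharpHalves.HalfL
  rw [GammaLc_pendant_o p ends hf hleaf h3o h31 h32 hb]
  have hcross := (covC_cross_nonpos p ends hp o a₁ a₂ b).1
  have hq := sub_nonneg.2 (hp.le_one f)
  have hQ := prob_nonneg hp (avoidAll ends a₂ {a₁})
  have h2 : 0 ≤ 2 * (1 - p f) * prob p (avoidAll ends a₂ {a₁}) :=
    mul_nonneg (mul_nonneg (by norm_num) hq) hQ
  nlinarith [mul_nonneg h2 (neg_nonneg.2 hcross)]

/-- **HALF-H at every pendant `a₃` attached to `o`** (the root swap). -/
theorem HalfH_pendant_o (hp : IsProbVec p) {f : E} {a₃ o : V} (hf : ends f = s(a₃, o))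
    (hleaf : ∀ e, a₃ ∈ ends e → e = f) (h3o : a₃ ≠ o) {a₁ a₂ b : V} (h31 : a₃ ≠ a₁)
    (h32 : a₃ ≠ a₂) (hb : b ≠ a₃) : SharpHalves.HalfH p ends o a₁ a₂ a₃ b :=
  HalfL_pendant_o p ends hp hf hleaf h3o h32 h31 hb

end Theorem

end HalfLPendantO

end Summit.Ventures.PercRepro2
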